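import Literature.AlgebraicGeometry.Frobenioids.PadicKummerThm24iiOfGalois
import Literature.AnabelianGeometry.AbsoluteAnabelian.AbsAnabProp121viiInvariantMapProofs
import HarnessLib

/-!
# Frobenioids II, Theorem 2.4 (ii) at the Galois binding: the CANONICAL invariants are compatible

Mochizuki, *The geometry of Frobenioids II*, Kyushu J. Math. **62** (2008) 401–460, §2, Theorem 2.4
(ii) p. 20 [cite: MochizukiFrdII2008, Thm 2.4 (ii) p.20]: "If the `Φᵢ` are fieldwise saturated,
then the isomorphism `F_N(A₁) ⥲ F_N(A₂)` of (i) is compatible with the natural isomorphisms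
`F_N(Aᵢ) ⥲ ℤ/Nℤ` [cf. [NSW], Theorem 7.2.6]"; proof pp. 21–22: the natural isomorphisms are
"induced on subquotients [[NSW] (7.1.4)]" by the invariant of local class field theory, and the
compatibility is [AbsAnab] Prop 1.2.1 (vii).

abc-iut cell, W12 = `plan/L1/SUBDAG-FrdII-Thm24.md` rows L22/L23/L24, PIECE C′ (holder
abc-iut-w5-d201): the generic assembly `Def22Context.Iso.thm24ii_of_layerMaps`
(`PadicKummerThm24iiLayer.lean`) INSTANTIATED at the Galois-level contexts
`Def22Context.ofGalois Lᵢ Hᵢ …` of abc-iut-L1-t7/L1-d4 with the layer identifications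
`Θᵢ := Def22Context.fnLayerMap` and their naturality `fnLayerMap_isoFN` (abc-iut-L2-t12, PIECE B;
the instantiated compatibility itself is abc-iut-L2-t12's `Def22Context.Iso.thm24ii_ofGalois_layers`,
`PadicKummerThm24iiOfGalois.lean`, consumed here by name):

* `exists_thm24ii_ofGalois` — for `(N, Hᵢ)`-saturated contexts such pinned invariants EXIST (the
  residue maps exist uniquely, `Prop121vii.existsUniqueInvariantMap_holds`; `Θᵢ` is bijective,
  `fnLayerMap_bijective_of_isNHSaturated`), so Theorem 2.4 (ii) holds for THE canonical data.
What remains printed input, carried as hypotheses: the isomorphism `e` of Definition 2.2 data and the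
pair `(e.isoG, ψ̄)` with its three properties from an actual equivalence `Ψ` of `p`-adic Frobenioids
([FrdII] Thm 1.2 (i), Ex 1.3 (i); [AbsAnab] Prop 1.2.1 (iii)(iv); sub-DAG rows L02/L17).
Proof-only; universe `0`; nothing here concerns [IUTchIII].
-/

noncomputable section

namespace Literature.AlgebraicGeometry.Frobenioids

namespace PadicKummer

namespace Def22Context.Iso

open Field IntermediateField
open Literature.NumberTheory.GaloisRepresentations
open Literature.NumberTheory.GaloisRepresentations.LocalWeilDatum
open Literature.NumberTheory.GaloisRepresentations.DiscreteGaloisModule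
open Literature.AnabelianGeometry.AbsoluteAnabelian
open Literature.AnabelianGeometry.AbsoluteAnabelian.Prop121vii

variable {K₁ K₂ : Type} [Field K₁] [ValuativeRel K₁] [TopologicalSpace K₁]
  [IsNonarchimedeanLocalField K₁] [CharZero K₁] [Field K₂] [ValuativeRel K₂] [TopologicalSpace K₂]
  [IsNonarchimedeanLocalField K₂] [CharZero K₂]
  {L₁ : IntermediateField K₁ (AlgebraicClosure K₁)} [Normal K₁ L₁] [FiniteDimensional K₁ L₁]
  {AutC₁ O₁ : Type} [Group AutC₁] [CommMonoid O₁] [IsCancelMul O₁] [MulDistribMulAction AutC₁ O₁]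
  [MulDistribMulAction (L₁ ≃ₐ[K₁] L₁) O₁] {H₁ : Subgroup (absoluteGaloisGroup K₁)} [H₁.Normal]
  {hH₁ : IsOpen (H₁ : Set (absoluteGaloisGroup K₁))} {res₁ : AutC₁ →* (L₁ ≃ₐ[K₁] L₁)}
  {res_smul₁ : ∀ (α : AutC₁) (x : O₁), res₁ α • x = α • x}
  {L₂ : IntermediateField K₂ (AlgebraicClosure K₂)} [Normal K₂ L₂] [FiniteDimensional K₂ L₂]
  {AutC₂ O₂ : Type} [Group AutC₂] [CommMonoid O₂] [IsCancelMul O₂] [MulDistribMulAction AutC₂ O₂]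
  [MulDistribMulAction (L₂ ≃ₐ[K₂] L₂) O₂] {H₂ : Subgroup (absoluteGaloisGroup K₂)} [H₂.Normal]
  {hH₂ : IsOpen (H₂ : Set (absoluteGaloisGroup K₂))} {res₂ : AutC₂ →* (L₂ ≃ₐ[K₂] L₂)}
  {res_smul₂ : ∀ (α : AutC₂) (x : O₂), res₂ α • x = α • x}
  (e : Iso (ofGalois L₁ H₁ hH₁ res₁ res_smul₁) (ofGalois L₂ H₂ hH₂ res₂ res_smul₂)) (N : ℕ) [NeZero N]
  (m₁ : MuModel L₁ O₁ N) (m₂ : MuModel L₂ O₂ N)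
  (E₁ : Type) [Field E₁] [Algebra K₁ E₁] [FiniteDimensional K₁ E₁] [Finite (MuCarrier E₁ N)]
  (hHE₁ : H₁ = galFixing K₁ (embField K₁ E₁))
  (E₂ : Type) [Field E₂] [Algebra K₂ E₂] [FiniteDimensional K₂ E₂] [Finite (MuCarrier E₂ N)]
  (hHE₂ : H₂ = galFixing K₂ (embField K₂ E₂))

/-- **Theorem 2.4 (ii) holds for THE canonical invariants, which exist** (non-vacuity of
abc-iut-L2-t12's `thm24ii_ofGalois_layers`): for `(N, Hᵢ)`-saturated contexts (Def. 2.2 (ii)) the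
residue maps `inv_{Eᵢ}` of the layers exist (uniquely: `Prop121vii.existsUniqueInvariantMap_holds`), the identifications
`Θᵢ : F_N(Aᵢ) ⥲ H²(Γ_{Eᵢ}, μ_N)` are bijective (`fnLayerMap_bijective_of_isNHSaturated`), so the
invariants "induced on subquotients" `invᵢ := inv_{Eᵢ} ∘ Θᵢ : F_N(Aᵢ) ⥲ ℤ/Nℤ` exist, and for them
`Thm24ii … (e.thm24Data N) inv₁ inv₂`. [cite: MochizukiFrdII2008, Thm 2.4 (ii) p.20] -/
theorem exists_thm24ii_ofGalois (hc₁ : IsNHSaturated (ofGalois L₁ H₁ hH₁ res₁ res_smul₁) N)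
    (hc₂ : IsNHSaturated (ofGalois L₂ H₂ hH₂ res₂ res_smul₂) N)
    (ψbar : (AlgebraicClosure K₁)ˣ ≃* (AlgebraicClosure K₂)ˣ)
    (hψ : IsAlphaEquivariant e.isoG ψbar) (hu : PreservesAbsUnits ψbar)
    (hunif : PreservesUniformizers ψbar)
    (hO : ∀ ζ : Kummer.Mu N O₁,
      ((m₂.toMulEquiv (e.muIso N ζ) : rootsOfUnity N (AlgebraicClosure K₂)) : (AlgebraicClosure K₂)ˣ) =
        ψbar ((m₁.toMulEquiv ζ : rootsOfUnity N (AlgebraicClosure K₁)) : (AlgebraicClosure K₁)ˣ))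
    (fs₁ fs₂ : Prop) :
    letI := FiniteExtension.valuativeRel K₁ E₁
    letI := FiniteExtension.topologicalSpace K₁ E₁
    haveI := FiniteExtension.isNonarchimedeanLocalField K₁ E₁
    letI := FiniteExtension.valuativeRel K₂ E₂
    letI := FiniteExtension.topologicalSpace K₂ E₂
    haveI := FiniteExtension.isNonarchimedeanLocalField K₂ E₂
    ∃ (invE₁ : galoisCohomology (mu E₁ N) 2 →+ ZMod N) (invE₂ : galoisCohomology (mu E₂ N) 2 →+ ZMod N)
      (inv₁ : FNInvariant (ofGalois L₁ H₁ hH₁ res₁ res_smul₁) N)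
      (inv₂ : FNInvariant (ofGalois L₂ H₂ hH₂ res₂ res_smul₂) N),
      IsInvariantMap E₁ N invE₁ ∧ IsInvariantMap E₂ N invE₂ ∧
      (∀ x, inv₁.toAddEquiv x = invE₁ (fnLayerMap L₁ H₁ hH₁ res₁ res_smul₁ E₁ hHE₁ m₁ x)) ∧
      (∀ x, inv₂.toAddEquiv x = invE₂ (fnLayerMap L₂ H₂ hH₂ res₂ res_smul₂ E₂ hHE₂ m₂ x)) ∧
      Thm24ii _ _ N fs₁ fs₂ (e.thm24Data N) inv₁ inv₂ := by
  letI := FiniteExtension.valuativeRel K₁ E₁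
  letI := FiniteExtension.topologicalSpace K₁ E₁
  haveI := FiniteExtension.isNonarchimedeanLocalField K₁ E₁
  letI := FiniteExtension.valuativeRel K₂ E₂
  letI := FiniteExtension.topologicalSpace K₂ E₂
  haveI := FiniteExtension.isNonarchimedeanLocalField K₂ E₂
  haveI : CharZero E₁ := charZero_of_injective_algebraMap (algebraMap K₁ E₁).injective
  haveI : CharZero E₂ := charZero_of_injective_algebraMap (algebraMap K₂ E₂).injective
  obtain ⟨invE₁, hE₁, -⟩ := existsUniqueInvariantMap_holds E₁ N
  obtain ⟨invE₂, hE₂, -⟩ := existsUniqueInvariantMap_holds E₂ N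
  obtain ⟨inv₁, hpin₁⟩ := exists_fnInvariant_pinned (fnLayerMap L₁ H₁ hH₁ res₁ res_smul₁ E₁ hHE₁ m₁)
    (fnLayerMap_bijective_of_isNHSaturated L₁ H₁ hH₁ res₁ res_smul₁ E₁ hHE₁ m₁ hc₁) invE₁ hE₁.1
  obtain ⟨inv₂, hpin₂⟩ := exists_fnInvariant_pinned (fnLayerMap L₂ H₂ hH₂ res₂ res_smul₂ E₂ hHE₂ m₂)
    (fnLayerMap_bijective_of_isNHSaturated L₂ H₂ hH₂ res₂ res_smul₂ E₂ hHE₂ m₂ hc₂) invE₂ hE₂.1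
  exact ⟨invE₁, invE₂, inv₁, inv₂, hE₁, hE₂, hpin₁, hpin₂,
    e.thm24ii_ofGalois_layers N m₁ m₂ E₁ hHE₁ E₂ hHE₂ ψbar hψ hu hunif hO invE₁ invE₂ fs₁ fs₂ inv₁
      inv₂ hpin₁ hpin₂ hE₁ hE₂⟩

end Def22Context.Iso

/-! ### The arithmetic context `Def22Context.ofLocalField` (`O^□(A) = O^□_L ⊆ L ⊆ K̄`) -/

namespace Def22Context.Iso

open Field IntermediateField
open Literature.NumberTheory.GaloisRepresentations
open Literature.NumberTheory.GaloisRepresentations.LocalWeilDatum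
open Literature.NumberTheory.GaloisRepresentations.DiscreteGaloisModule
open Literature.AnabelianGeometry.AbsoluteAnabelian
open Literature.AnabelianGeometry.AbsoluteAnabelian.Prop121vii

variable {K₁ K₂ : Type} [Field K₁] [ValuativeRel K₁] [TopologicalSpace K₁]
  [IsNonarchimedeanLocalField K₁] [CharZero K₁] [Field K₂] [ValuativeRel K₂] [TopologicalSpace K₂]
  [IsNonarchimedeanLocalField K₂] [CharZero K₂]
  {L₁ : IntermediateField K₁ (AlgebraicClosure K₁)} [Normal K₁ L₁] [FiniteDimensional K₁ L₁]
  {H₁ : Subgroup (absoluteGaloisGroup K₁)} [H₁.Normal] {hH₁ : IsOpen (H₁ : Set (absoluteGaloisGroup K₁))}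
  {S₁ : StableSubmonoid L₁}
  {L₂ : IntermediateField K₂ (AlgebraicClosure K₂)} [Normal K₂ L₂] [FiniteDimensional K₂ L₂]
  {H₂ : Subgroup (absoluteGaloisGroup K₂)} [H₂.Normal] {hH₂ : IsOpen (H₂ : Set (absoluteGaloisGroup K₂))}
  {S₂ : StableSubmonoid L₂}
  (e : Iso (ofLocalField L₁ H₁ hH₁ S₁) (ofLocalField L₂ H₂ hH₂ S₂)) (N : ℕ) [NeZero N]
  (hS₁ : ∀ x : L₁, x ^ N = 1 → x ∈ S₁.toSubmonoid)
  (hμ₁ : ∀ ζ : rootsOfUnity N (AlgebraicClosure K₁),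
    ((ζ : (AlgebraicClosure K₁)ˣ) : AlgebraicClosure K₁) ∈ L₁)
  (hS₂ : ∀ x : L₂, x ^ N = 1 → x ∈ S₂.toSubmonoid)
  (hμ₂ : ∀ ζ : rootsOfUnity N (AlgebraicClosure K₂),
    ((ζ : (AlgebraicClosure K₂)ˣ) : AlgebraicClosure K₂) ∈ L₂)
  (E₁ : IntermediateField K₁ (AlgebraicClosure K₁)) [FiniteDimensional K₁ E₁] [Normal K₁ E₁]
  [Finite (MuCarrier E₁ N)] (hE₁ : galFixing K₁ E₁ = H₁)
  (E₂ : IntermediateField K₂ (AlgebraicClosure K₂)) [FiniteDimensional K₂ E₂] [Normal K₂ E₂]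
  [Finite (MuCarrier E₂ N)] (hE₂ : galFixing K₂ E₂ = H₂)

include hE₁ in
omit [ValuativeRel K₁] [TopologicalSpace K₁] [IsNonarchimedeanLocalField K₁] [CharZero K₁]
  [FiniteDimensional K₁ E₁] [Finite (MuCarrier E₁ N)] [H₁.Normal] in
/-- For the field `E₀ = K̄^H` itself (normal over `K`), `Gal(K̄/ι⁻¹E₀) = Gal(K̄/E₀) = H`.
[cite: MochizukiFrdII2008, Def 2.2 (i) p.17] -/
theorem H_eq_galFixing_embField : H₁ = galFixing K₁ (embField K₁ E₁) := by
  rw [Def22Context.embField_eq_of_normal]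
  exact hE₁.symm

/-- **Theorem 2.4 (ii) at the arithmetic context `ofLocalField`, for THE canonical invariants**
(FrdII p. 20–22; `O^□(Aᵢ) = O^□_{Lᵢ}`, `Aut_{Eᵢ}((Aᵢ)_{Eᵢ}) = Gal(Lᵢ/Kᵢ)`, `Hᵢ = Gal(K̄ᵢ/Eᵢ)`): for an
isomorphism `e` of the Definition 2.2 data (induced by `Ψ`) and `ψ̄ : K̄₁^× ⥲ K̄₂^×` `e.isoG`-equivariant,
absolute units to units, `K₁`-uniformisers to `K₂`-uniformisers, AGREEING WITH `e.isoO` ON `O^□_{L₁}`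
("`Ψ` preserves `O^⊳(−)`", p. 20; `hisoO`), and `(N, Hᵢ)`-saturated contexts with `μ_N(K̄ᵢ) ⊆ Lᵢ`:
the invariants `invᵢ : F_N(Aᵢ) ⥲ ℤ/Nℤ` "induced on subquotients by the invariant of local class field
theory" — i.e. `invᵢ = inv_{Eᵢ} ∘ Θᵢ` for the residue maps `inv_{Eᵢ}` of the local fields
`Eᵢ = K̄ᵢ^{Hᵢ}` and the identifications `Θᵢ : F_N(Aᵢ) ⥲ H²(Gal(K̄ᵢ/Eᵢ), μ_N)` — EXIST and "the
isomorphism `F_N(A₁) ⥲ F_N(A₂)` of (i) is compatible with" them: `Thm24ii … (e.thm24Data N) inv₁ inv₂`.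
[cite: MochizukiFrdII2008, Thm 2.4 (ii) p.20] -/
theorem exists_thm24ii_ofLocalField (hc₁ : IsNHSaturated (ofLocalField L₁ H₁ hH₁ S₁) N)
    (hc₂ : IsNHSaturated (ofLocalField L₂ H₂ hH₂ S₂) N)
    (ψbar : (AlgebraicClosure K₁)ˣ ≃* (AlgebraicClosure K₂)ˣ)
    (hψ : IsAlphaEquivariant e.isoG ψbar) (hu : PreservesAbsUnits ψbar)
    (hunif : PreservesUniformizers ψbar)
    (hisoO : ∀ u : (GalMonoid S₁)ˣ,
      Units.map (GalMonoid.toClosure S₂) (Units.map (e.isoO : GalMonoid S₁ →* GalMonoid S₂) u) =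
        ψbar (Units.map (GalMonoid.toClosure S₁) u))
    (fs₁ fs₂ : Prop) :
    letI := FiniteExtension.valuativeRel K₁ E₁
    letI := FiniteExtension.topologicalSpace K₁ E₁
    haveI := FiniteExtension.isNonarchimedeanLocalField K₁ E₁
    letI := FiniteExtension.valuativeRel K₂ E₂
    letI := FiniteExtension.topologicalSpace K₂ E₂
    haveI := FiniteExtension.isNonarchimedeanLocalField K₂ E₂
    ∃ (invE₁ : galoisCohomology (mu E₁ N) 2 →+ ZMod N) (invE₂ : galoisCohomology (mu E₂ N) 2 →+ ZMod N)
      (inv₁ : FNInvariant (ofLocalField L₁ H₁ hH₁ S₁) N)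
      (inv₂ : FNInvariant (ofLocalField L₂ H₂ hH₂ S₂) N),
      IsInvariantMap E₁ N invE₁ ∧ IsInvariantMap E₂ N invE₂ ∧
      (∀ x, inv₁.toAddEquiv x = invE₁ (fnLayerMap L₁ H₁ hH₁ (MonoidHom.id _) (fun _ _ => rfl) E₁
        (H_eq_galFixing_embField E₁ hE₁) (muModelOfSubmonoid L₁ S₁ N hS₁ (NeZero.pos N) hμ₁) x)) ∧
      (∀ x, inv₂.toAddEquiv x = invE₂ (fnLayerMap L₂ H₂ hH₂ (MonoidHom.id _) (fun _ _ => rfl) E₂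
        (H_eq_galFixing_embField E₂ hE₂) (muModelOfSubmonoid L₂ S₂ N hS₂ (NeZero.pos N) hμ₂) x)) ∧
      Thm24ii _ _ N fs₁ fs₂ (e.thm24Data N) inv₁ inv₂ := by
  refine e.exists_thm24ii_ofGalois N (muModelOfSubmonoid L₁ S₁ N hS₁ (NeZero.pos N) hμ₁)
    (muModelOfSubmonoid L₂ S₂ N hS₂ (NeZero.pos N) hμ₂) E₁ (H_eq_galFixing_embField E₁ hE₁) E₂
    (H_eq_galFixing_embField E₂ hE₂) hc₁ hc₂ ψbar hψ hu hunif (fun ζ => ?_) fs₁ fs₂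
  -- `hO`: on `μ_N(A₁) ⊆ O^□_{L₁}ˣ`, `e.muIso` is `ψ̄` through the tautological models
  have h1 : (((muModelOfSubmonoid L₁ S₁ N hS₁ (NeZero.pos N) hμ₁).toMulEquiv ζ :
        rootsOfUnity N (AlgebraicClosure K₁)) : (AlgebraicClosure K₁)ˣ) =
      Units.map (GalMonoid.toClosure S₁) ζ.val := Units.ext rfl
  have h2 : (((muModelOfSubmonoid L₂ S₂ N hS₂ (NeZero.pos N) hμ₂).toMulEquiv (e.muIso N ζ) :
        rootsOfUnity N (AlgebraicClosure K₂)) : (AlgebraicClosure K₂)ˣ) =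
      Units.map (GalMonoid.toClosure S₂) (e.muIso N ζ).val := Units.ext rfl
  have h3 : (e.muIso N ζ).val = Units.map (e.isoO : GalMonoid S₁ →* GalMonoid S₂) ζ.val :=
    Units.ext (e.coe_val_muIso N ζ)
  rw [h1, h2, h3, hisoO]

end Def22Context.Iso

end PadicKummer

end Literature.AlgebraicGeometry.Frobenioids
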